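import Mathlib.Algebra.Algebra.Operations
import Mathlib.LinearAlgebra.FiniteDimensional.Lemmas
import Mathlib.RingTheory.Finiteness.Subalgebra
import Mathlib.LinearAlgebra.Dimension.Finrank
import Mathlib.LinearAlgebra.Dimension.Free
import Mathlib.FieldTheory.IntermediateField.Basic
import HarnessLib

/-!
# Kneser's theorem for field extensions — boundary operator and saturation (Bachoc–Serra–Zémor §2.1, §2.3)

Topic `Literature/Combinatorics/Additive`. This is the first of the PROOF files behind the named
fact `Literature.Combinatorics.Additive.LinearKneser` (`LinearKneser.lean`): the linear Kneser
theorem of Hou–Leung–Xiang WITHOUT the separability assumption, following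
C. Bachoc, O. Serra, G. Zémor, *Revisiting Kneser's theorem for field extensions*,
Combinatorica 38 (2018) 759–777 = arXiv:1510.01354 (cited below as BSZ; section and statement
numbers are those of the arXiv version).

Setting: `F ⊆ L` fields (`Algebra F L`), `S` an `F`-subspace of `L` (later: finite-dimensional
with `1 ∈ S`), products `X * S` of `F`-subspaces = the `F`-span of the products (Mathlib's
`Submodule` multiplication), translates `a • X = {a x : x ∈ X}` (pointwise action of `L`).

* `bdry S X = dim_F (X S) - dim_F X` — the boundary operator `∂_S X` of BSZ §2.1 (we only ever
  apply it to finite-dimensional `X`; with `1 ∈ S`, `X ≤ X S` so the subtraction is genuine,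
  `bdry_add_finrank`).
* `satur S X = {x ∈ L : x S ⊆ X S}` — the saturation `X̃` of BSZ §2.3; `X` is *saturated* when
  `satur S X = X`.
* submodularity `bdry S (X ⊔ Y) + bdry S (X ⊓ Y) ≤ bdry S X + bdry S Y` (BSZ Prop. 5, here only
  for finite-dimensional `X, Y`, where it is the modular law), and its saturated form.
* `cells S` — the finite-dimensional saturated subspaces `X` with `⊥ < X < ⊤` (BSZ's family `𝒮`
  restricted to FINITE-dimensional members: the whole proof is re-engineered so that the duals
  `X* = (XS)^⊥` of BSZ, which have finite codimension, never have to be treated as cells — see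
  `LinearKneserDuality.lean`), `levels S = {bdry S X : X ∈ cells S}` (BSZ's `Λ ∖ {0}`).
* field-valued stabilisers: `toIntermediateField` (a finite-dimensional subspace containing `1`
  and closed under products is a subfield), the tower-law divisibility
  `finrank_dvd_of_stable` and the elementary `finrank_add_finrank_le_of_stable_lt`
  (`U < V` both `K`-stable ⇒ `dim U + [K:F] ≤ dim V`), used in BSZ Lemma 17 / Lemma 18 / Prop. 22.

Design: no `Prop`-valued definitions (saturation is the equation `satur S X = X`, cells are a
`Set`); finite-dimensionality of `X * S` and `a • X` is recorded as theorems made local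
instances in the proof files.

## References
* [BachocSerraZemor2018Kneser] C. Bachoc, O. Serra, G. Zémor, Combinatorica 38 (2018) 759–777,
  §2.1 (boundary operator, Prop. 5), §2.3 (saturation), §3 (cells).
-/

noncomputable section

open Module Submodule
open scoped Pointwise

namespace Literature.Combinatorics.Additive.LinKneser

variable {F L : Type*} [Field F] [Field L] [Algebra F L]

/-! ### Finite-dimensionality and translates -/

/-- The product of two finite-dimensional subspaces of an algebra is finite-dimensional.
[folklore] -/
theorem finiteDimensional_mul (X S : Submodule F L) [hX : FiniteDimensional F X]
    [hS : FiniteDimensional F S] : FiniteDimensional F ↥(X * S) :=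
  Module.Finite.iff_fg.mpr ((Module.Finite.iff_fg.mp hX).mul (Module.Finite.iff_fg.mp hS))

/-- A translate `a • X` of a finite-dimensional subspace is finite-dimensional. [folklore] -/
theorem finiteDimensional_smul (a : L) (X : Submodule F L) [FiniteDimensional F X] :
    FiniteDimensional F ↥(a • X) := by
  rw [Submodule.pointwise_smul_def]; infer_instance

attribute [local instance] finiteDimensional_mul finiteDimensional_smul

/-- Membership in a translate: `x ∈ a • X ↔ x = a y` for some `y ∈ X`. [folklore] -/
theorem mem_smul_iff {a x : L} {X : Submodule F L} : x ∈ a • X ↔ ∃ y ∈ X, a * y = x :=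
  Submodule.mem_smul_pointwise_iff_exists x a X

/-- `a y ∈ a • X` for `y ∈ X`. [folklore] -/
theorem mul_mem_smul {a y : L} {X : Submodule F L} (hy : y ∈ X) : a * y ∈ a • X :=
  mem_smul_iff.mpr ⟨y, hy, rfl⟩

/-- For `a ≠ 0`, `a y ∈ a • X ↔ y ∈ X`. [folklore] -/
theorem mul_mem_smul_iff {a y : L} {X : Submodule F L} (ha : a ≠ 0) : a * y ∈ a • X ↔ y ∈ X := by
  refine ⟨fun h => ?_, mul_mem_smul⟩
  obtain ⟨z, hz, hzy⟩ := mem_smul_iff.mp h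
  rwa [← mul_left_cancel₀ ha hzy]

/-- `a ∈ a • X` when `1 ∈ X`. [folklore] -/
theorem self_mem_smul {a : L} {X : Submodule F L} (h1 : (1 : L) ∈ X) : a ∈ a • X := by
  simpa using mul_mem_smul (a := a) h1

/-- Translation is injective on subspaces for `a ≠ 0`: `a⁻¹ • a • X = X`. [folklore] -/
theorem inv_smul_smul {a : L} (ha : a ≠ 0) (X : Submodule F L) : a⁻¹ • a • X = X :=
  inv_smul_smul₀ ha X

/-- Translation preserves dimension (`a ≠ 0`). [folklore] -/
theorem finrank_smul {a : L} (ha : a ≠ 0) (X : Submodule F L) :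
    finrank F ↥(a • X) = finrank F X := by
  have hinj : Function.Injective (DistribSMul.toLinearMap F L a) := by
    intro x y hxy
    simpa [DistribSMul.toLinearMap_apply, ha] using hxy
  exact (LinearEquiv.finrank_eq (Submodule.equivMapOfInjective _ hinj X)).symm

/-- Translation is monotone. [folklore] -/
theorem smul_mono {a : L} {X Y : Submodule F L} (h : X ≤ Y) : a • X ≤ a • Y :=
  Submodule.map_mono h

/-- Translation by `a ≠ 0` reflects inclusion. [folklore] -/
theorem smul_le_smul_iff {a : L} (ha : a ≠ 0) {X Y : Submodule F L} : a • X ≤ a • Y ↔ X ≤ Y := by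
  refine ⟨fun h => ?_, smul_mono⟩
  have := smul_mono (a := a⁻¹) h
  rwa [inv_smul_smul ha, inv_smul_smul ha] at this

/-- Translation by `a ≠ 0` commutes with intersections. [folklore] -/
theorem smul_inf {a : L} (ha : a ≠ 0) (X Y : Submodule F L) : a • (X ⊓ Y) = a • X ⊓ a • Y := by
  refine le_antisymm (le_inf (smul_mono inf_le_left) (smul_mono inf_le_right)) ?_
  intro x hx
  obtain ⟨y, hy, rfl⟩ := mem_smul_iff.mp hx.1
  exact mul_mem_smul ⟨hy, (mul_mem_smul_iff ha).mp hx.2⟩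

/-- Translation commutes with sums. [folklore] -/
theorem smul_sup (a : L) (X Y : Submodule F L) : a • (X ⊔ Y) = a • X ⊔ a • Y :=
  Submodule.smul_sup' a X Y

/-- Translation commutes with products: `(a • X) S = a • (X S)`. [folklore] -/
theorem smul_mul (a : L) (X S : Submodule F L) : (a • X) * S = a • (X * S) :=
  smul_mul_assoc a X S

/-- `a • X = ⊥ ↔ X = ⊥` for `a ≠ 0`. [folklore] -/
theorem smul_eq_bot_iff {a : L} (ha : a ≠ 0) {X : Submodule F L} : a • X = ⊥ ↔ X = ⊥ := by
  constructor
  · intro h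
    rw [← inv_smul_smul ha X, h]
    exact Submodule.smul_bot' _
  · rintro rfl
    exact Submodule.smul_bot' _

/-- `a • X = ⊤ ↔ X = ⊤` for `a ≠ 0`. [folklore] -/
theorem smul_eq_top_iff {a : L} (ha : a ≠ 0) {X : Submodule F L} : a • X = ⊤ ↔ X = ⊤ := by
  have key : ∀ {b : L}, b ≠ 0 → ∀ {Y : Submodule F L}, Y = ⊤ → b • Y = ⊤ := by
    intro b hb Y hY
    rw [hY, eq_top_iff]
    intro x _
    exact mem_smul_iff.mpr ⟨b⁻¹ * x, Submodule.mem_top, by rw [mul_inv_cancel_left₀ hb]⟩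
  refine ⟨fun h => ?_, key ha⟩
  rw [← inv_smul_smul ha X]
  exact key (inv_ne_zero ha) h

/-- The line through `a`: `a • (F · 1) = F · a`. [folklore] -/
theorem smul_span_one (a : L) : a • (Submodule.span F {(1 : L)}) = Submodule.span F {a} := by
  rw [Submodule.pointwise_smul_def, Submodule.map_span]
  simp

/-! ### Products with `S` and the boundary operator -/

/-- With `1 ∈ S`, `X ≤ X S`. [folklore] -/
theorem le_mul_of_one_mem {S : Submodule F L} (h1 : (1 : L) ∈ S) (X : Submodule F L) :
    X ≤ X * S := fun x hx => by simpa using Submodule.mul_mem_mul hx h1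

/-- `x S = x • S` as subspaces (`F x · S`). [folklore] -/
theorem span_singleton_mul (x : L) (S : Submodule F L) : Submodule.span F {x} * S = x • S :=
  Submodule.span_singleton_mul

/-- For `x ∈ X`, `x • S ≤ X S`. [folklore] -/
theorem smul_le_mul {x : L} {X : Submodule F L} (hx : x ∈ X) (S : Submodule F L) :
    x • S ≤ X * S := by
  rw [← span_singleton_mul]
  exact mul_le_mul_left ((Submodule.span_singleton_le_iff_mem x X).mpr hx) S

/-- The boundary operator `∂_S X = dim_F (X S) - dim_F X` of a subspace `X` with respect to `S`.
For finite-dimensional `X` and `1 ∈ S` this is the dimension of `XS / X`.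
[cite: BachocSerraZemor2018Kneser, Section 2.1] -/
def bdry (S X : Submodule F L) : ℕ := finrank F ↥(X * S) - finrank F ↥X

/-- `dim X ≤ dim XS` (for `1 ∈ S`, finite-dimensional `X, S`). [folklore] -/
theorem finrank_le_finrank_mul {S : Submodule F L} (h1 : (1 : L) ∈ S) (X : Submodule F L)
    [FiniteDimensional F X] [FiniteDimensional F S] : finrank F X ≤ finrank F ↥(X * S) :=
  Submodule.finrank_mono (le_mul_of_one_mem h1 X)

/-- `∂X + dim X = dim XS`. [cite: BachocSerraZemor2018Kneser, Section 2.1] -/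
theorem bdry_add_finrank {S : Submodule F L} (h1 : (1 : L) ∈ S) (X : Submodule F L)
    [FiniteDimensional F X] [FiniteDimensional F S] :
    bdry S X + finrank F X = finrank F ↥(X * S) :=
  Nat.sub_add_cancel (finrank_le_finrank_mul h1 X)

/-- The boundary is translation invariant: `∂(a • X) = ∂X` (`a ≠ 0`).
[cite: BachocSerraZemor2018Kneser, Section 3] -/
theorem bdry_smul {a : L} (ha : a ≠ 0) (S X : Submodule F L) : bdry S (a • X) = bdry S X := by
  unfold bdry
  rw [smul_mul, finrank_smul ha, finrank_smul ha]

/-- `∂ ⊥ = 0`. [folklore] -/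
theorem bdry_bot (S : Submodule F L) : bdry S ⊥ = 0 := by
  have : ((⊥ : Submodule F L) * S) = ⊥ := Submodule.bot_mul S
  rw [bdry, this, finrank_bot]

/-! ### Saturation -/

/-- The saturation `X̃ = {x ∈ L : x S ⊆ X S}` of a subspace `X` with respect to `S`.
[cite: BachocSerraZemor2018Kneser, Section 2.3] -/
def satur (S X : Submodule F L) : Submodule F L where
  carrier := {x | ∀ s ∈ S, x * s ∈ X * S}
  add_mem' {a b} ha hb s hs := by
    rw [add_mul]
    exact Submodule.add_mem _ (ha s hs) (hb s hs)
  zero_mem' _ _ := by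
    rw [zero_mul]
    exact Submodule.zero_mem _
  smul_mem' c {a} ha s hs := by
    rw [smul_mul_assoc c a s]
    exact Submodule.smul_mem _ c (ha s hs)

/-- Membership in the saturation. [cite: BachocSerraZemor2018Kneser, Section 2.3] -/
theorem mem_satur {S X : Submodule F L} {x : L} : x ∈ satur S X ↔ ∀ s ∈ S, x * s ∈ X * S :=
  Iff.rfl

/-- Membership in the saturation, subspace form: `x ∈ X̃ ↔ x • S ≤ X S`.
[cite: BachocSerraZemor2018Kneser, Section 2.3] -/
theorem mem_satur_iff_smul_le {S X : Submodule F L} {x : L} : x ∈ satur S X ↔ x • S ≤ X * S := by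
  constructor
  · intro h y hy
    obtain ⟨s, hs, rfl⟩ := mem_smul_iff.mp hy
    exact h s hs
  · intro h s hs
    exact h (mul_mem_smul hs)

/-- `X ≤ X̃`. [cite: BachocSerraZemor2018Kneser, Section 2.3] -/
theorem le_satur (S X : Submodule F L) : X ≤ satur S X :=
  fun _ hx _ hs => Submodule.mul_mem_mul hx hs

/-- `X̃ S = X S`. [cite: BachocSerraZemor2018Kneser, Section 2.3] -/
theorem satur_mul (S X : Submodule F L) : satur S X * S = X * S :=
  le_antisymm (Submodule.mul_le.mpr fun _ hx _ hs => hx _ hs)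
    (mul_le_mul_left (le_satur S X) S)

/-- With `1 ∈ S`, `X̃ ≤ X S`; in particular `X̃` is finite-dimensional when `X, S` are.
[cite: BachocSerraZemor2018Kneser, Section 2.3] -/
theorem satur_le_mul {S : Submodule F L} (h1 : (1 : L) ∈ S) (X : Submodule F L) :
    satur S X ≤ X * S := fun x hx => by simpa using hx 1 h1

/-- Saturation is monotone. [cite: BachocSerraZemor2018Kneser, Section 2.3] -/
theorem satur_mono (S : Submodule F L) {X Y : Submodule F L} (h : X ≤ Y) : satur S X ≤ satur S Y :=
  fun _ hx s hs => mul_le_mul_left h S (hx s hs)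

/-- Saturation is idempotent. [cite: BachocSerraZemor2018Kneser, Section 2.3] -/
theorem satur_satur (S X : Submodule F L) : satur S (satur S X) = satur S X := by
  refine le_antisymm (fun x hx s hs => ?_) (le_satur _ _)
  rw [← satur_mul S X]
  exact hx s hs

/-- The saturation is finite-dimensional (for `1 ∈ S`). [folklore] -/
theorem finiteDimensional_satur {S : Submodule F L} (h1 : (1 : L) ∈ S) (X : Submodule F L)
    [FiniteDimensional F X] [FiniteDimensional F S] : FiniteDimensional F ↥(satur S X) :=
  Submodule.finiteDimensional_of_le (satur_le_mul h1 X)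

/-- Saturation commutes with translation (`a ≠ 0`). [cite: BachocSerraZemor2018Kneser, Section 3] -/
theorem satur_smul {a : L} (ha : a ≠ 0) (S X : Submodule F L) :
    satur S (a • X) = a • satur S X := by
  ext x
  rw [mem_satur, smul_mul]
  constructor
  · intro h
    refine mem_smul_iff.mpr ⟨a⁻¹ * x, fun s hs => ?_, by rw [mul_inv_cancel_left₀ ha]⟩
    have := h s hs
    rw [← mul_mem_smul_iff ha, ← mul_assoc, mul_inv_cancel_left₀ ha]
    exact this
  · intro h s hs
    obtain ⟨y, hy, rfl⟩ := mem_smul_iff.mp h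
    rw [mul_assoc]
    exact mul_mem_smul (hy s hs)

/-- A translate of a saturated subspace is saturated. [cite: BachocSerraZemor2018Kneser, Section 3] -/
theorem satur_smul_of_eq {a : L} (ha : a ≠ 0) {S X : Submodule F L} (hX : satur S X = X) :
    satur S (a • X) = a • X := by
  rw [satur_smul ha, hX]

/-- An intersection of saturated subspaces is saturated.
[cite: BachocSerraZemor2018Kneser, Lemma 11 (iv)] -/
theorem satur_inf_of_eq {S X Y : Submodule F L} (hX : satur S X = X) (hY : satur S Y = Y) :
    satur S (X ⊓ Y) = X ⊓ Y := by
  refine le_antisymm ?_ (le_satur _ _)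
  calc satur S (X ⊓ Y) ≤ satur S X ⊓ satur S Y :=
        le_inf (satur_mono S inf_le_left) (satur_mono S inf_le_right)
    _ = X ⊓ Y := by rw [hX, hY]

/-- `⊤` is saturated. [folklore] -/
theorem satur_top (S : Submodule F L) : satur S ⊤ = ⊤ :=
  eq_top_iff.mpr (le_satur S ⊤)

/-- `∂X̃ + dim X̃ = dim XS = ∂X + dim X`; in particular `∂X̃ ≤ ∂X`.
[cite: BachocSerraZemor2018Kneser, Section 2.3] -/
theorem bdry_satur_add_finrank {S : Submodule F L} (h1 : (1 : L) ∈ S) (X : Submodule F L)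
    [FiniteDimensional F X] [FiniteDimensional F S] :
    haveI := finiteDimensional_satur h1 X
    bdry S (satur S X) + finrank F ↥(satur S X) = finrank F ↥(X * S) := by
  haveI := finiteDimensional_satur h1 X
  rw [bdry_add_finrank h1, satur_mul]

/-- `∂X̃ ≤ ∂X`. [cite: BachocSerraZemor2018Kneser, Section 2.3] -/
theorem bdry_satur_le {S : Submodule F L} (h1 : (1 : L) ∈ S) (X : Submodule F L)
    [FiniteDimensional F X] [FiniteDimensional F S] : bdry S (satur S X) ≤ bdry S X := by
  haveI := finiteDimensional_satur h1 X
  have h := bdry_satur_add_finrank h1 X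
  have h' := bdry_add_finrank h1 X
  have hle : finrank F X ≤ finrank F ↥(satur S X) := Submodule.finrank_mono (le_satur S X)
  omega

/-- If `X̃ = ⊤` then `X S = ⊤`. [folklore] -/
theorem mul_eq_top_of_satur_eq_top {S : Submodule F L} (h1 : (1 : L) ∈ S) {X : Submodule F L}
    (h : satur S X = ⊤) : X * S = ⊤ :=
  eq_top_iff.mpr (h ▸ satur_le_mul h1 X)

/-! ### Submodularity (BSZ Proposition 5, finite-dimensional case) -/

/-- `(X ⊓ Y) S ≤ X S ⊓ Y S`. [folklore] -/
theorem inf_mul_le (X Y S : Submodule F L) : (X ⊓ Y) * S ≤ X * S ⊓ Y * S :=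
  le_inf (mul_le_mul_left inf_le_left S) (mul_le_mul_left inf_le_right S)

/-- Submodularity of the boundary operator (BSZ Prop. 5) for finite-dimensional `X, Y`:
`∂(X + Y) + ∂(X ∩ Y) ≤ ∂X + ∂Y`. [cite: BachocSerraZemor2018Kneser, Proposition 5] -/
theorem bdry_sup_add_bdry_inf_le {S : Submodule F L} (h1 : (1 : L) ∈ S) (X Y : Submodule F L)
    [FiniteDimensional F X] [FiniteDimensional F Y] [FiniteDimensional F S] :
    bdry S (X ⊔ Y) + bdry S (X ⊓ Y) ≤ bdry S X + bdry S Y := by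
  have e1 := bdry_add_finrank h1 (X ⊔ Y)
  have e2 := bdry_add_finrank h1 (X ⊓ Y)
  have e3 := bdry_add_finrank h1 X
  have e4 := bdry_add_finrank h1 Y
  have m1 := Submodule.finrank_sup_add_finrank_inf_eq X Y
  have m2 := Submodule.finrank_sup_add_finrank_inf_eq (X * S) (Y * S)
  have i1 : finrank F ↥((X ⊓ Y) * S) ≤ finrank F ↥(X * S ⊓ Y * S) :=
    Submodule.finrank_mono (inf_mul_le X Y S)
  rw [Submodule.sup_mul] at e1
  omega

/-- Submodularity with the saturated sum: `∂(X + Y)̃ + ∂(X ∩ Y) ≤ ∂X + ∂Y`.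
[cite: BachocSerraZemor2018Kneser, Proposition 5] -/
theorem bdry_satur_sup_add_bdry_inf_le {S : Submodule F L} (h1 : (1 : L) ∈ S)
    (X Y : Submodule F L) [FiniteDimensional F X] [FiniteDimensional F Y]
    [FiniteDimensional F S] :
    bdry S (satur S (X ⊔ Y)) + bdry S (X ⊓ Y) ≤ bdry S X + bdry S Y :=
  (Nat.add_le_add_right (bdry_satur_le h1 _) _).trans (bdry_sup_add_bdry_inf_le h1 X Y)

/-! ### Cells and levels -/

/-- The cells of `S`: finite-dimensional saturated subspaces `X` with `⊥ < X < ⊤` (the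
finite-dimensional members of BSZ's family `𝒮`, levels `≥ 1`).
[cite: BachocSerraZemor2018Kneser, Section 3] -/
def cells (S : Submodule F L) : Set (Submodule F L) :=
  {X | FiniteDimensional F X ∧ satur S X = X ∧ X ≠ ⊥ ∧ X ≠ ⊤}

/-- The set `Λ ∖ {0}` of boundaries of cells. [cite: BachocSerraZemor2018Kneser, Section 3] -/
def levels (S : Submodule F L) : Set ℕ := {n | ∃ X ∈ cells S, bdry S X = n}

/-- Unfolding `cells`. [cite: BachocSerraZemor2018Kneser, Section 3] -/
theorem mem_cells {S X : Submodule F L} :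
    X ∈ cells S ↔ FiniteDimensional F X ∧ satur S X = X ∧ X ≠ ⊥ ∧ X ≠ ⊤ :=
  Iff.rfl

/-- The boundary of a cell is a level. [cite: BachocSerraZemor2018Kneser, Section 3] -/
theorem bdry_mem_levels {S X : Submodule F L} (hX : X ∈ cells S) : bdry S X ∈ levels S :=
  ⟨X, hX, rfl⟩

/-- A translate of a cell is a cell. [cite: BachocSerraZemor2018Kneser, Section 3] -/
theorem smul_mem_cells {a : L} (ha : a ≠ 0) {S X : Submodule F L} (hX : X ∈ cells S) :
    a • X ∈ cells S := by
  obtain ⟨hfd, hsat, hb, ht⟩ := hX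
  exact ⟨finiteDimensional_smul a X, satur_smul_of_eq ha hsat, (smul_eq_bot_iff ha).not.mpr hb,
    (smul_eq_top_iff ha).not.mpr ht⟩

/-! ### Field-valued stabilisers -/

/-- A finite-dimensional subspace `N` of the field `L` with `1 ∈ N` and `N N ⊆ N` is a subfield
(inverses: multiplication by `x ≠ 0` is an injective, hence surjective, endomorphism of `N`).
[cite: BachocSerraZemor2018Kneser, Section 2.3 (remark before Corollary 14)] -/
def toIntermediateField (N : Submodule F L) (h1 : (1 : L) ∈ N) (hmul : N * N ≤ N)
    [FiniteDimensional F N] : IntermediateField F L where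
  toSubalgebra :=
    { carrier := N
      mul_mem' := fun ha hb => hmul (Submodule.mul_mem_mul ha hb)
      one_mem' := h1
      add_mem' := fun ha hb => N.add_mem ha hb
      zero_mem' := N.zero_mem
      algebraMap_mem' := fun c => by
        rw [Algebra.algebraMap_eq_smul_one]
        exact N.smul_mem c h1 }
  inv_mem' x (hx : x ∈ N) := by
    change x⁻¹ ∈ N
    by_cases hx0 : x = 0
    · simp [hx0]
    · let f : N →ₗ[F] N :=
        { toFun := fun y => ⟨x * y, hmul (Submodule.mul_mem_mul hx y.2)⟩
          map_add' := fun y z => by ext; simp [mul_add]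
          map_smul' := fun c y => by ext; simp }
      have hinj : Function.Injective f := by
        intro y z hyz
        have : x * y = x * z := congrArg Subtype.val hyz
        exact Subtype.ext (mul_left_cancel₀ hx0 this)
      obtain ⟨y, hy⟩ := (LinearMap.injective_iff_surjective.mp hinj) ⟨1, h1⟩
      have hxy : x * y = 1 := congrArg Subtype.val hy
      have : (y : L) = x⁻¹ := by
        rw [← mul_inv_cancel₀ hx0] at hxy
        exact mul_left_cancel₀ hx0 hxy
      rw [← this]
      exact y.2

/-- Membership in `toIntermediateField N`. [folklore] -/
@[simp] theorem mem_toIntermediateField {N : Submodule F L} {h1 : (1 : L) ∈ N} {hmul : N * N ≤ N}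
    [FiniteDimensional F N] {x : L} : x ∈ toIntermediateField N h1 hmul ↔ x ∈ N :=
  Iff.rfl

/-- `toIntermediateField N` has the same `F`-dimension as `N`. [folklore] -/
theorem finrank_toIntermediateField (N : Submodule F L) (h1 : (1 : L) ∈ N) (hmul : N * N ≤ N)
    [FiniteDimensional F N] : finrank F (toIntermediateField N h1 hmul) = finrank F N := by
  let e : ↥(toIntermediateField N h1 hmul) ≃ₗ[F] N :=
    { toFun := fun x => ⟨x.1, x.2⟩
      invFun := fun x => ⟨x.1, x.2⟩
      map_add' := fun _ _ => rfl
      map_smul' := fun _ _ => rfl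
      left_inv := fun _ => rfl
      right_inv := fun _ => rfl }
  exact e.finrank_eq

/-- Tower law divisibility: if an `F`-subspace `V` of `L` is stable under an intermediate field
`K`, then `[K : F] ∣ dim_F V` (`V` is a `K`-vector space). [folklore] -/
theorem finrank_dvd_of_stable (K : IntermediateField F L) (V : Submodule F L)
    (hKV : ∀ k ∈ K, ∀ v ∈ V, k * v ∈ V) : finrank F K ∣ finrank F V := by
  let V' : Submodule K L :=
    { carrier := V
      add_mem' := fun ha hb => V.add_mem ha hb
      zero_mem' := V.zero_mem
      smul_mem' := fun c x hx => hKV c c.2 x hx }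
  have htower := Module.finrank_mul_finrank F K ↥V'
  have hres : finrank F ↥V' = finrank F V := by
    let e : ↥V' ≃ₗ[F] V :=
      { toFun := fun x => ⟨x.1, x.2⟩
        invFun := fun x => ⟨x.1, x.2⟩
        map_add' := fun _ _ => rfl
        map_smul' := fun _ _ => rfl
        left_inv := fun _ => rfl
        right_inv := fun _ => rfl }
    exact e.finrank_eq
  exact ⟨finrank K ↥V', by rw [← hres, ← htower]⟩

/-- A nonzero subspace stable under an intermediate field `K` has dimension `≥ [K : F]`
(finite-dimensional `K`). [folklore] -/
theorem finrank_le_of_stable (K : IntermediateField F L) [FiniteDimensional F K]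
    {V : Submodule F L} [FiniteDimensional F V] (hKV : ∀ k ∈ K, ∀ v ∈ V, k * v ∈ V) {v : L}
    (hv : v ∈ V) (hv0 : v ≠ 0) : finrank F K ≤ finrank F V := by
  -- the map `k ↦ k v` embeds `K` into `V`
  let f : K →ₗ[F] V :=
    { toFun := fun k => ⟨k * v, hKV k k.2 v hv⟩
      map_add' := fun a b => by ext; simp [add_mul]
      map_smul' := fun c a => by ext; simp }
  have hinj : Function.Injective f := by
    intro a b hab
    have : (a : L) * v = b * v := congrArg Subtype.val hab
    exact Subtype.ext (mul_right_cancel₀ hv0 this)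
  exact LinearMap.finrank_le_finrank_of_injective hinj

/-- If `U < V` are subspaces both stable under an intermediate field `K` (finite-dimensional),
then `dim U + [K : F] ≤ dim V`: for `v ∈ V ∖ U` the `K`-line `K v ≤ V` meets `U` trivially.
[cite: BachocSerraZemor2018Kneser, proof of Lemma 18] -/
theorem finrank_add_finrank_le_of_stable_lt (K : IntermediateField F L) [FiniteDimensional F K]
    {U V : Submodule F L} [FiniteDimensional F V] (hKU : ∀ k ∈ K, ∀ u ∈ U, k * u ∈ U)
    (hKV : ∀ k ∈ K, ∀ v ∈ V, k * v ∈ V) (hlt : U < V) :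
    finrank F U + finrank F K ≤ finrank F V := by
  obtain ⟨hle, hne⟩ := lt_iff_le_and_ne.mp hlt
  obtain ⟨v, hvV, hvU⟩ : ∃ v ∈ V, v ∉ U := by
    by_contra h
    push Not at h
    exact hne (le_antisymm hle h)
  have hv0 : v ≠ 0 := fun h => hvU (h ▸ U.zero_mem)
  -- the `K`-line through `v`
  let W : Submodule F L := v • K.toSubalgebra.toSubmodule
  haveI : FiniteDimensional F ↥(Subalgebra.toSubmodule K.toSubalgebra) :=
    (inferInstance : FiniteDimensional F K)
  have hWV : W ≤ V := by
    intro x hx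
    obtain ⟨k, hk, rfl⟩ := mem_smul_iff.mp hx
    rw [mul_comm]
    exact hKV k hk v hvV
  have hWU : U ⊓ W = ⊥ := by
    rw [eq_bot_iff]
    intro x ⟨hxU, hxW⟩
    obtain ⟨k, hk, rfl⟩ := mem_smul_iff.mp hxW
    by_contra hx0
    have hk0 : (k : L) ≠ 0 := by
      rintro rfl
      exact hx0 (by simp)
    have : v ∈ U := by
      have := hKU k⁻¹ (K.inv_mem hk) _ hxU
      rwa [mul_comm v k, ← mul_assoc, inv_mul_cancel₀ hk0, one_mul] at this
    exact hvU this
  have hW : finrank F W = finrank F K := by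
    rw [finrank_smul hv0]
    rfl
  haveI : FiniteDimensional F U := Submodule.finiteDimensional_of_le hle
  have hsum := Submodule.finrank_sup_add_finrank_inf_eq U W
  rw [hWU, finrank_bot, add_zero] at hsum
  have hUW : finrank F ↥(U ⊔ W) ≤ finrank F V := Submodule.finrank_mono (sup_le hle hWV)
  omega

end Literature.Combinatorics.Additive.LinKneser
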